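import Literature.Analysis.Calculus.PadicChordMethod
import Literature.NumberTheory.EllipticCurves.BinaryQuarticInvariantMapSubmersiveProofs
import Literature.NumberTheory.EllipticCurves.BinaryQuarticLocalSolubility
import HarnessLib

/-!
# Local sections of the invariant map over `ℤ_p`: near a form `f₀` with `Δ(f₀) ≠ 0`, every
# `(I, J) ≡ (I(f₀), J(f₀)) (mod p^{k+c})` is `(I(g), J(g))` for some `g ≡ f₀ (mod pᵏ)`

`Proofs` companion (theorems only: no definitions, no named facts) of `BinaryQuarticForms.lean` and
`BinaryQuarticInvariantMapSubmersiveProofs.lean` (`648Δ` lies in the ideal of the `2 × 2` minors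
`m_{ab}, m_{ac}, m_{ad}` of the Jacobian of `(I, J)`, so one of them is nonzero wherever `Δ ≠ 0`),
using the two-variable Hensel lemma `Literature.Analysis.Calculus.exists_zero_of_chord`.

Source and role. M. Bhargava, A. Shankar, *Binary quartic forms having bounded invariants, and
the boundedness of the average rank of elliptic curves*, Ann. of Math. (2) 181 (2015) 191–242: the
`p`-adic change-of-measure statements of §3.4 of the published version (Props. 3.7–3.9 = Prop. 5.12
of `arXiv:1006.1002v2`), like the real Prop. 2.8, parametrise `V_{ℤ_p}` near a form with `Δ ≠ 0` by
`PGL₂ × (I, J)`; over `ℤ_p` this needs that **the invariant map `(I, J) : V_{ℤ_p} → ℤ_p²` has local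
sections through every `f₀` with `Δ(f₀) ≠ 0`, with a loss of precision bounded in terms of
`v_p(Δ(f₀))`**. This file proves exactly that:

* `BinaryQuartic.exists_invariants_eq_near_of_minor_ab` (and `_ac`, `_ad`) — the chord method in
  the two coordinates `(a, b)` (resp. `(a, c)`, `(a, d)`), the others being frozen: if the minor
  `m = m_{ab}(f₀) ≠ 0`, `δ = |m|_p`, and `max(|I₁ − I(f₀)|, |J₁ − J(f₀)|) ≤ δ²/p`, there is an
  integral `g` with `(I(g), J(g)) = (I₁, J₁)`, differing from `f₀` only in those two coordinates,
  by at most `δ⁻¹ max(|I₁ − I(f₀)|, |J₁ − J(f₀)|)`;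
* `BinaryQuartic.exists_invariants_eq_near` — **for `Δ(f₀) ≠ 0` there is `c` such that for all
  `k` and all `(I₁, J₁) ≡ (I(f₀), J(f₀)) (mod p^{k+c})` some `g ≡ f₀ (mod pᵏ)` (coefficientwise) has
  `I(g) = I₁`, `J(g) = J₁`** (`c = 2v_p(m) + 1` for a nonzero minor `m`).

The exact expansions `(I, J)(f₀ + t e_a + s e_j) = (I, J)(f₀) + L(t, s) + Q(t, s)` with `Q`
polynomial without constant or linear terms (`I_J_family_ab` etc.) are checked by `ring`; the
Lipschitz bounds for `Q` on balls of radius `≤ 1` are elementary ultrametric estimates.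

## References

* M. Bhargava, A. Shankar, Ann. of Math. (2) 181 (2015) 191–242, §3.4 (Props. 3.7–3.9) of the
  published version; Prop. 5.12 of arXiv:1006.1002v2. [cite: BhargavaShankarAnnals2015, Prop. 5.12 (arXiv:1006.1002v2 numbering)]
-/

noncomputable section

open Metric Set Literature.Analysis.Calculus

namespace Literature.NumberTheory.EllipticCurves

namespace BinaryQuartic

variable {p : ℕ} [Fact p.Prime]

/-! ## Ultrametric Lipschitz estimates for monomials of degree `2` and `3` -/

/-- `|s² − s'²| ≤ max(|s|,|s'|)·|s − s'|`. [folklore] -/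
theorem norm_sq_sub_sq_le (s s' : ℚ_[p]) : ‖s ^ 2 - s' ^ 2‖ ≤ max ‖s‖ ‖s'‖ * ‖s - s'‖ := by
  rw [show s ^ 2 - s' ^ 2 = (s + s') * (s - s') by ring, norm_mul]
  exact mul_le_mul_of_nonneg_right (Padic.nonarchimedean _ _) (norm_nonneg _)

/-- `|ts − t's'| ≤ max(|t|,|t'|,|s|,|s'|)·max(|t − t'|, |s − s'|)`. [folklore] -/
theorem norm_mul_sub_mul_le (t s t' s' : ℚ_[p]) :
    ‖t * s - t' * s'‖ ≤ max (max ‖t‖ ‖t'‖) (max ‖s‖ ‖s'‖) * max ‖t - t'‖ ‖s - s'‖ := by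
  rw [show t * s - t' * s' = t * (s - s') + (t - t') * s' by ring]
  refine (Padic.nonarchimedean _ _).trans (max_le ?_ ?_)
  · rw [norm_mul]
    exact mul_le_mul (le_max_of_le_left (le_max_left _ _)) (le_max_right _ _) (norm_nonneg _) (by positivity)
  · rw [norm_mul, mul_comm]
    exact mul_le_mul (le_max_of_le_right (le_max_right _ _)) (le_max_left _ _) (norm_nonneg _) (by positivity)

/-- `|s³ − s'³| ≤ max(|s|,|s'|)²·|s − s'|`. [folklore] -/
theorem norm_cube_sub_cube_le (s s' : ℚ_[p]) : ‖s ^ 3 - s' ^ 3‖ ≤ max ‖s‖ ‖s'‖ ^ 2 * ‖s - s'‖ := by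
  rw [show s ^ 3 - s' ^ 3 = (s ^ 2 + s * s' + s' ^ 2) * (s - s') by ring, norm_mul]
  refine mul_le_mul_of_nonneg_right ?_ (norm_nonneg _)
  refine (Padic.nonarchimedean _ _).trans (max_le ((Padic.nonarchimedean _ _).trans (max_le ?_ ?_)) ?_)
  · rw [norm_pow]; exact pow_le_pow_left₀ (norm_nonneg _) (le_max_left _ _) 2
  · rw [norm_mul, sq]; exact mul_le_mul (le_max_left _ _) (le_max_right _ _) (norm_nonneg _) (by positivity)
  · rw [norm_pow]; exact pow_le_pow_left₀ (norm_nonneg _) (le_max_right _ _) 2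

/-- `|ts² − t's'²| ≤ max(|t|,|t'|,|s|,|s'|)²·max(|t − t'|, |s − s'|)`. [folklore] -/
theorem norm_mul_sq_sub_le (t s t' s' : ℚ_[p]) :
    ‖t * s ^ 2 - t' * s' ^ 2‖ ≤ max (max ‖t‖ ‖t'‖) (max ‖s‖ ‖s'‖) ^ 2 * max ‖t - t'‖ ‖s - s'‖ := by
  set M := max (max ‖t‖ ‖t'‖) (max ‖s‖ ‖s'‖) with hM
  have hM0 : 0 ≤ M := le_max_of_le_left (le_max_of_le_left (norm_nonneg _))
  rw [show t * s ^ 2 - t' * s' ^ 2 = t * (s ^ 2 - s' ^ 2) + (t - t') * s' ^ 2 by ring]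
  refine (Padic.nonarchimedean _ _).trans (max_le ?_ ?_)
  · rw [norm_mul]
    calc ‖t‖ * ‖s ^ 2 - s' ^ 2‖ ≤ M * (max ‖s‖ ‖s'‖ * ‖s - s'‖) :=
          mul_le_mul (le_max_of_le_left (le_max_left _ _)) (norm_sq_sub_sq_le s s') (norm_nonneg _) hM0
      _ ≤ M * (M * max ‖t - t'‖ ‖s - s'‖) := by
          refine mul_le_mul_of_nonneg_left (mul_le_mul (le_max_right _ _) (le_max_right _ _) (norm_nonneg _) hM0) hM0
      _ = M ^ 2 * max ‖t - t'‖ ‖s - s'‖ := by ring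
  · rw [norm_mul, norm_pow]
    calc ‖t - t'‖ * ‖s'‖ ^ 2 ≤ max ‖t - t'‖ ‖s - s'‖ * M ^ 2 :=
          mul_le_mul (le_max_left _ _) (pow_le_pow_left₀ (norm_nonneg _)
            (le_max_of_le_right (le_max_right _ _)) 2) (by positivity) (by positivity)
      _ = M ^ 2 * max ‖t - t'‖ ‖s - s'‖ := by ring

/-- Scaling by an integral coefficient does not increase norms of differences. [folklore] -/
theorem norm_coef_mul_sub_le {c : ℚ_[p]} (hc : ‖c‖ ≤ 1) (x y : ℚ_[p]) : ‖c * x - c * y‖ ≤ ‖x - y‖ := by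
  rw [← mul_sub, norm_mul]; exact mul_le_of_le_one_left (norm_nonneg _) hc

/-- For `h, h'` in the closed ball of radius `r ≤ 1` of `ℚ_p²`, the quantity
`M = max(|t|,|t'|,|s|,|s'|)` satisfies `M ≤ r`, `M² ≤ r` and `max(|t−t'|,|s−s'|) = ‖h − h'‖`. [folklore] -/
theorem ball_aux {r : ℝ} (hr1 : r ≤ 1) {h h' : ℚ_[p] × ℚ_[p]} (hh : h ∈ closedBall (0 : ℚ_[p] × ℚ_[p]) r)
    (hh' : h' ∈ closedBall (0 : ℚ_[p] × ℚ_[p]) r) :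
    max (max ‖h.1‖ ‖h'.1‖) (max ‖h.2‖ ‖h'.2‖) ≤ r ∧
      max (max ‖h.1‖ ‖h'.1‖) (max ‖h.2‖ ‖h'.2‖) ^ 2 ≤ r ∧
      max ‖h.1 - h'.1‖ ‖h.2 - h'.2‖ = ‖h - h'‖ := by
  rw [mem_closedBall, dist_zero_right, Prod.norm_def] at hh hh'
  have hM : max (max ‖h.1‖ ‖h'.1‖) (max ‖h.2‖ ‖h'.2‖) ≤ r :=
    max_le (max_le ((le_max_left _ _).trans hh) ((le_max_left _ _).trans hh'))
      (max_le ((le_max_right _ _).trans hh) ((le_max_right _ _).trans hh'))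
  have hM0 : 0 ≤ max (max ‖h.1‖ ‖h'.1‖) (max ‖h.2‖ ‖h'.2‖) := le_max_of_le_left (le_max_of_le_left (norm_nonneg _))
  refine ⟨hM, ?_, by rw [Prod.norm_def]; rfl⟩
  calc _ = max (max ‖h.1‖ ‖h'.1‖) (max ‖h.2‖ ‖h'.2‖) * max (max ‖h.1‖ ‖h'.1‖) (max ‖h.2‖ ‖h'.2‖) := sq _
    _ ≤ r * 1 := mul_le_mul hM (hM.trans hr1) hM0 (hM0.trans hM)
    _ = r := mul_one r

/-! ## The three coordinate families and their exact expansions -/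

variable (f : BinaryQuartic ℚ_[p])

/-- `(I, J)` along `(a, b) ↦ (a + t, b + s)`: linear part `L = (12e, −3d; 72ce − 27d², 9cd − 54be)`,
remainder `Q = (0, −27e s²)`. [folklore] -/
theorem I_J_family_ab (t s : ℚ_[p]) :
    (⟨f.a + t, f.b + s, f.c, f.d, f.e⟩ : BinaryQuartic ℚ_[p]).I = f.I + (12 * f.e * t + -3 * f.d * s) ∧
    (⟨f.a + t, f.b + s, f.c, f.d, f.e⟩ : BinaryQuartic ℚ_[p]).J =
      f.J + ((72 * f.c * f.e - 27 * f.d ^ 2) * t + (9 * f.c * f.d - 54 * f.b * f.e) * s) + (-27 * f.e * s ^ 2) := by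
  constructor
  · simp only [I]; ring
  · simp only [J]; ring

/-- `(I, J)` along `(a, c) ↦ (a + t, c + s)`: `L = (12e, 2c; 72ce − 27d², 72ae + 9bd − 6c²)`,
`Q = (s², 72e ts − 6c s² − 2s³)`. [folklore] -/
theorem I_J_family_ac (t s : ℚ_[p]) :
    (⟨f.a + t, f.b, f.c + s, f.d, f.e⟩ : BinaryQuartic ℚ_[p]).I = f.I + (12 * f.e * t + 2 * f.c * s) + s ^ 2 ∧
    (⟨f.a + t, f.b, f.c + s, f.d, f.e⟩ : BinaryQuartic ℚ_[p]).J =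
      f.J + ((72 * f.c * f.e - 27 * f.d ^ 2) * t + (72 * f.a * f.e + 9 * f.b * f.d - 6 * f.c ^ 2) * s)
        + (72 * f.e * (t * s) - 6 * f.c * s ^ 2 - 2 * s ^ 3) := by
  constructor
  · simp only [I]; ring
  · simp only [J]; ring

/-- `(I, J)` along `(a, d) ↦ (a + t, d + s)`: `L = (12e, −3b; 72ce − 27d², 9bc − 54ad)`,
`Q = (0, −54d ts − 27a s² − 27 ts²)`. [folklore] -/
theorem I_J_family_ad (t s : ℚ_[p]) :
    (⟨f.a + t, f.b, f.c, f.d + s, f.e⟩ : BinaryQuartic ℚ_[p]).I = f.I + (12 * f.e * t + -3 * f.b * s) ∧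
    (⟨f.a + t, f.b, f.c, f.d + s, f.e⟩ : BinaryQuartic ℚ_[p]).J =
      f.J + ((72 * f.c * f.e - 27 * f.d ^ 2) * t + (9 * f.b * f.c - 54 * f.a * f.d) * s)
        + (-54 * f.d * (t * s) - 27 * f.a * s ^ 2 - 27 * (t * s ^ 2)) := by
  constructor
  · simp only [I]; ring
  · simp only [J]; ring

/-! ## Integral forms: the three local sections -/

/-- Entries of norm `≤ 1` give a determinant of norm `≤ 1`. [folklore] -/
theorem norm_det_le_one {l₁₁ l₁₂ l₂₁ l₂₂ : ℚ_[p]} (h₁₁ : ‖l₁₁‖ ≤ 1) (h₁₂ : ‖l₁₂‖ ≤ 1)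
    (h₂₁ : ‖l₂₁‖ ≤ 1) (h₂₂ : ‖l₂₂‖ ≤ 1) : ‖l₁₁ * l₂₂ - l₁₂ * l₂₁‖ ≤ 1 := by
  rw [sub_eq_add_neg]
  refine (Padic.nonarchimedean _ _).trans (max_le ?_ ?_)
  · rw [norm_mul]; exact mul_le_one₀ h₁₁ (norm_nonneg _) h₂₂
  · rw [norm_neg, norm_mul]; exact mul_le_one₀ h₁₂ (norm_nonneg _) h₂₁

/-- Coefficients of the image of an integral form have norm `≤ 1`. [folklore] -/
theorem norm_coe_le_one (x : ℤ_[p]) : ‖(x : ℚ_[p])‖ ≤ 1 := by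
  rw [PadicInt.padic_norm_e_of_padicInt]; exact PadicInt.norm_le_one x

/-- A polynomial expression in integral elements is integral: closure of `{‖·‖ ≤ 1}` under `+`, `*`,
`−` and numerals, packaged for the linear coefficients below. [folklore] -/
theorem norm_le_one_of_mul {x y : ℚ_[p]} (hx : ‖x‖ ≤ 1) (hy : ‖y‖ ≤ 1) : ‖x * y‖ ≤ 1 := by
  rw [norm_mul]; exact mul_le_one₀ hx (norm_nonneg _) hy

omit [Fact p.Prime] in
/-- Numerals are integral. [folklore] -/
theorem norm_natCast_le_one' [Fact p.Prime] (n : ℕ) : ‖(n : ℚ_[p])‖ ≤ 1 := by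
  have := Padic.norm_int_le_one (p := p) (n : ℤ)
  simpa using this

/-- `‖x + y‖ ≤ 1` and `‖x − y‖ ≤ 1` for integral `x, y`. [folklore] -/
theorem norm_le_one_of_add_sub {x y : ℚ_[p]} (hx : ‖x‖ ≤ 1) (hy : ‖y‖ ≤ 1) :
    ‖x + y‖ ≤ 1 ∧ ‖x - y‖ ≤ 1 :=
  ⟨(Padic.nonarchimedean _ _).trans (max_le hx hy),
    by rw [sub_eq_add_neg]; exact (Padic.nonarchimedean _ _).trans (max_le hx (by rwa [norm_neg]))⟩

/-- From a zero `(t, s)` of norm `≤ 1` of the `(a, b)`-family to an integral form with the prescribed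
invariants. [folklore] -/
theorem exists_form_ab (f₀ : BinaryQuartic ℤ_[p]) (I₁ J₁ : ℤ_[p]) {t s : ℚ_[p]} (ht : ‖t‖ ≤ 1) (hs : ‖s‖ ≤ 1)
    (hI : (⟨(f₀.a : ℚ_[p]) + t, (f₀.b : ℚ_[p]) + s, f₀.c, f₀.d, f₀.e⟩ : BinaryQuartic ℚ_[p]).I = I₁)
    (hJ : (⟨(f₀.a : ℚ_[p]) + t, (f₀.b : ℚ_[p]) + s, f₀.c, f₀.d, f₀.e⟩ : BinaryQuartic ℚ_[p]).J = J₁) :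
    ∃ g : BinaryQuartic ℤ_[p], g.I = I₁ ∧ g.J = J₁ ∧ g.c = f₀.c ∧ g.d = f₀.d ∧ g.e = f₀.e ∧
      ((g.a - f₀.a : ℤ_[p]) : ℚ_[p]) = t ∧ ((g.b - f₀.b : ℤ_[p]) : ℚ_[p]) = s := by
  set g : BinaryQuartic ℤ_[p] := ⟨f₀.a + ⟨t, ht⟩, f₀.b + ⟨s, hs⟩, f₀.c, f₀.d, f₀.e⟩ with hg
  have hmap : g.map PadicInt.Coe.ringHom =
      (⟨(f₀.a : ℚ_[p]) + t, (f₀.b : ℚ_[p]) + s, f₀.c, f₀.d, f₀.e⟩ : BinaryQuartic ℚ_[p]) := by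
    ext <;> rfl
  refine ⟨g, ?_, ?_, rfl, rfl, rfl, ?_, ?_⟩
  · apply Subtype.coe_injective
    have := congrArg BinaryQuartic.I hmap
    rw [I_map] at this
    exact this.trans hI
  · apply Subtype.coe_injective
    have := congrArg BinaryQuartic.J hmap
    rw [J_map] at this
    exact this.trans hJ
  · change (((f₀.a + ⟨t, ht⟩ - f₀.a : ℤ_[p]) : ℚ_[p])) = t
    rw [PadicInt.coe_sub, PadicInt.coe_add]; change (f₀.a : ℚ_[p]) + t - f₀.a = t; ring
  · change (((f₀.b + ⟨s, hs⟩ - f₀.b : ℤ_[p]) : ℚ_[p])) = s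
    rw [PadicInt.coe_sub, PadicInt.coe_add]; change (f₀.b : ℚ_[p]) + s - f₀.b = s; ring

/-- **The local section in the coordinates `(a, b)`.** If the minor
`m = m_{ab} = (12e)(9cd − 54be) − (−3d)(−27d² + 72ce)` of the integral form `f₀` is nonzero (in `ℚ_p`)
and `max(|I₁ − I(f₀)|, |J₁ − J(f₀)|) ≤ |m|²/p`, there is an integral `g` with `(I, J)(g) = (I₁, J₁)`,
`(c, d, e)(g) = (c, d, e)(f₀)` and `|a(g) − a(f₀)|, |b(g) − b(f₀)| ≤ |m|⁻¹ max(|I₁ − I(f₀)|, |J₁ − J(f₀)|)`.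
[cite: BhargavaShankarAnnals2015, Prop. 5.12 (local structure of (I,J) over ℤ_p; arXiv:1006.1002v2 numbering)] -/
theorem exists_invariants_eq_near_of_minor_ab (f₀ : BinaryQuartic ℤ_[p]) (I₁ J₁ : ℤ_[p])
    (hm : (12 * (f₀.e : ℚ_[p])) * (9 * (f₀.c : ℚ_[p]) * f₀.d - 54 * (f₀.b : ℚ_[p]) * f₀.e)
      - (-3 * (f₀.d : ℚ_[p])) * (-27 * (f₀.d : ℚ_[p]) ^ 2 + 72 * (f₀.c : ℚ_[p]) * f₀.e) ≠ 0)
    (hsmall : max ‖((I₁ - f₀.I : ℤ_[p]) : ℚ_[p])‖ ‖((J₁ - f₀.J : ℤ_[p]) : ℚ_[p])‖ ≤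
      ‖(12 * (f₀.e : ℚ_[p])) * (9 * (f₀.c : ℚ_[p]) * f₀.d - 54 * (f₀.b : ℚ_[p]) * f₀.e)
        - (-3 * (f₀.d : ℚ_[p])) * (-27 * (f₀.d : ℚ_[p]) ^ 2 + 72 * (f₀.c : ℚ_[p]) * f₀.e)‖ *
      (‖(12 * (f₀.e : ℚ_[p])) * (9 * (f₀.c : ℚ_[p]) * f₀.d - 54 * (f₀.b : ℚ_[p]) * f₀.e)
        - (-3 * (f₀.d : ℚ_[p])) * (-27 * (f₀.d : ℚ_[p]) ^ 2 + 72 * (f₀.c : ℚ_[p]) * f₀.e)‖ / p)) :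
    ∃ g : BinaryQuartic ℤ_[p], g.I = I₁ ∧ g.J = J₁ ∧ g.c = f₀.c ∧ g.d = f₀.d ∧ g.e = f₀.e ∧
      max ‖((g.a - f₀.a : ℤ_[p]) : ℚ_[p])‖ ‖((g.b - f₀.b : ℤ_[p]) : ℚ_[p])‖ ≤
        ‖(12 * (f₀.e : ℚ_[p])) * (9 * (f₀.c : ℚ_[p]) * f₀.d - 54 * (f₀.b : ℚ_[p]) * f₀.e)
          - (-3 * (f₀.d : ℚ_[p])) * (-27 * (f₀.d : ℚ_[p]) ^ 2 + 72 * (f₀.c : ℚ_[p]) * f₀.e)‖⁻¹ *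
        max ‖((I₁ - f₀.I : ℤ_[p]) : ℚ_[p])‖ ‖((J₁ - f₀.J : ℤ_[p]) : ℚ_[p])‖ := by
  set F : BinaryQuartic ℚ_[p] := f₀.map PadicInt.Coe.ringHom with hF
  have hFa : F.a = f₀.a := rfl
  have hFb : F.b = f₀.b := rfl
  have hFc : F.c = f₀.c := rfl
  have hFd : F.d = f₀.d := rfl
  have hFe : F.e = f₀.e := rfl
  have hFI : F.I = (f₀.I : ℚ_[p]) := I_map _ _
  have hFJ : F.J = (f₀.J : ℚ_[p]) := J_map _ _
  -- the data of the chord method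
  set l₁₁ : ℚ_[p] := 12 * F.e
  set l₁₂ : ℚ_[p] := -3 * F.d
  set l₂₁ : ℚ_[p] := -27 * F.d ^ 2 + 72 * F.c * F.e
  set l₂₂ : ℚ_[p] := 9 * F.c * F.d - 54 * F.b * F.e
  have ha1 := norm_coe_le_one f₀.a; have hb1 := norm_coe_le_one f₀.b; have hc1 := norm_coe_le_one f₀.c
  have hd1 := norm_coe_le_one f₀.d; have he1 := norm_coe_le_one f₀.e
  have h₁₁ : ‖l₁₁‖ ≤ 1 := norm_le_one_of_mul (norm_natCast_le_one' 12) he1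
  have h₁₂ : ‖l₁₂‖ ≤ 1 := by
    change ‖-3 * (f₀.d : ℚ_[p])‖ ≤ 1
    rw [neg_mul, norm_neg]; exact norm_le_one_of_mul (norm_natCast_le_one' 3) hd1
  have hd2 : ‖(F.d : ℚ_[p]) ^ 2‖ ≤ 1 := by rw [norm_pow]; exact pow_le_one₀ (norm_nonneg _) hd1
  have h27d2 : ‖-27 * (F.d : ℚ_[p]) ^ 2‖ ≤ 1 := by
    rw [neg_mul, norm_neg]; exact norm_le_one_of_mul (norm_natCast_le_one' 27) hd2
  have h₂₁ : ‖l₂₁‖ ≤ 1 :=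
    (norm_le_one_of_add_sub h27d2 (norm_le_one_of_mul (norm_le_one_of_mul (norm_natCast_le_one' 72) hc1) he1)).1
  have h₂₂ : ‖l₂₂‖ ≤ 1 :=
    (norm_le_one_of_add_sub (norm_le_one_of_mul (norm_le_one_of_mul (norm_natCast_le_one' 9) hc1) hd1)
      (norm_le_one_of_mul (norm_le_one_of_mul (norm_natCast_le_one' 54) hb1) he1)).2
  have hdet : l₁₁ * l₂₂ - l₁₂ * l₂₁ ≠ 0 := hm
  set δ : ℝ := ‖l₁₁ * l₂₂ - l₁₂ * l₂₁‖ with hδ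
  have hδ1 : δ ≤ 1 := norm_det_le_one h₁₁ h₁₂ h₂₁ h₂₂
  have hp1 : (1 : ℝ) < p := by exact_mod_cast (Fact.out : p.Prime).one_lt
  have hr1 : δ / p ≤ 1 := (div_le_self (norm_nonneg _) hp1.le).trans hδ1
  -- the map and its remainder
  let fam : ℚ_[p] × ℚ_[p] → BinaryQuartic ℚ_[p] := fun h ↦ ⟨F.a + h.1, F.b + h.2, F.c, F.d, F.e⟩
  let G : ℚ_[p] × ℚ_[p] → ℚ_[p] × ℚ_[p] := fun h ↦ ((fam h).I - (I₁ : ℚ_[p]), (fam h).J - (J₁ : ℚ_[p]))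
  let Q : ℚ_[p] × ℚ_[p] → ℚ_[p] × ℚ_[p] := fun h ↦ (0, -27 * F.e * h.2 ^ 2)
  have hG0 : G 0 = (F.I - (I₁ : ℚ_[p]), F.J - (J₁ : ℚ_[p])) := by
    have h := I_J_family_ab F 0 0
    ext
    · change (fam 0).I - (I₁ : ℚ_[p]) = F.I - I₁
      rw [show fam 0 = ⟨F.a + 0, F.b + 0, F.c, F.d, F.e⟩ from rfl, h.1]; ring
    · change (fam 0).J - (J₁ : ℚ_[p]) = F.J - J₁
      rw [show fam 0 = ⟨F.a + 0, F.b + 0, F.c, F.d, F.e⟩ from rfl, h.2]; ring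
  have hG : ∀ h, G h = G 0 + (l₁₁ * h.1 + l₁₂ * h.2, l₂₁ * h.1 + l₂₂ * h.2) + Q h := fun h ↦ by
    have hh := I_J_family_ab F h.1 h.2
    rw [hG0]
    ext
    · change (fam h).I - (I₁ : ℚ_[p]) = (F.I - I₁) + (l₁₁ * h.1 + l₁₂ * h.2) + 0
      rw [show fam h = ⟨F.a + h.1, F.b + h.2, F.c, F.d, F.e⟩ from rfl, hh.1]; ring
    · change (fam h).J - (J₁ : ℚ_[p]) = (F.J - J₁) + (l₂₁ * h.1 + l₂₂ * h.2) + -27 * F.e * h.2 ^ 2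
      rw [show fam h = ⟨F.a + h.1, F.b + h.2, F.c, F.d, F.e⟩ from rfl, hh.2]; ring
  have hQ0 : Q 0 = 0 := by
    ext
    · rfl
    · change -27 * F.e * (0 : ℚ_[p]) ^ 2 = 0; ring
  have hQ : ∀ h ∈ closedBall (0 : ℚ_[p] × ℚ_[p]) (δ / p), ∀ h' ∈ closedBall (0 : ℚ_[p] × ℚ_[p]) (δ / p),
      ‖Q h - Q h'‖ ≤ δ / p * ‖h - h'‖ := fun h hh h' hh' ↦ by
    obtain ⟨hM, -, hdiff⟩ := ball_aux hr1 hh hh'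
    rw [Prod.norm_def]
    refine max_le ?_ ?_
    · change ‖(0 : ℚ_[p]) - 0‖ ≤ δ / p * ‖h - h'‖
      rw [sub_zero, norm_zero]; positivity
    change ‖-27 * F.e * h.2 ^ 2 - -27 * F.e * h'.2 ^ 2‖ ≤ δ / p * ‖h - h'‖
    have hcoef : ‖-27 * F.e‖ ≤ 1 := by
      rw [neg_mul, norm_neg]; exact norm_le_one_of_mul (norm_natCast_le_one' 27) he1
    refine (norm_coef_mul_sub_le hcoef _ _).trans ((norm_sq_sub_sq_le _ _).trans ?_)
    rw [← hdiff]
    exact mul_le_mul ((le_max_right _ _).trans hM) (le_max_right _ _) (norm_nonneg _) (by positivity)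
  have hsmall' : ‖G 0‖ ≤ δ * (δ / p) := by
    rw [hG0, Prod.norm_def]
    have h1 : ‖F.I - (I₁ : ℚ_[p])‖ = ‖((I₁ - f₀.I : ℤ_[p]) : ℚ_[p])‖ := by
      rw [hFI, ← norm_neg, PadicInt.coe_sub]; congr 1; ring
    have h2 : ‖F.J - (J₁ : ℚ_[p])‖ = ‖((J₁ - f₀.J : ℤ_[p]) : ℚ_[p])‖ := by
      rw [hFJ, ← norm_neg, PadicInt.coe_sub]; congr 1; ring
    change max ‖F.I - (I₁ : ℚ_[p])‖ ‖F.J - (J₁ : ℚ_[p])‖ ≤ _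
    rw [h1, h2]; exact hsmall
  obtain ⟨h, hGh, hbound, hball⟩ := exists_zero_of_chord h₁₁ h₁₂ h₂₁ h₂₂ hdet G Q hG hQ0 hQ hsmall'
  -- the zero gives the form
  have hh1 : ‖h.1‖ ≤ 1 := (norm_fst_le h).trans (hball.trans hr1)
  have hh2 : ‖h.2‖ ≤ 1 := (norm_snd_le h).trans (hball.trans hr1)
  have hI : (fam h).I = I₁ := sub_eq_zero.mp (congrArg Prod.fst hGh)
  have hJ : (fam h).J = J₁ := sub_eq_zero.mp (congrArg Prod.snd hGh)
  obtain ⟨g, hgI, hgJ, hgc, hgd, hge, hga, hgb⟩ := exists_form_ab f₀ I₁ J₁ hh1 hh2 hI hJ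
  refine ⟨g, hgI, hgJ, hgc, hgd, hge, ?_⟩
  rw [hga, hgb, ← Prod.norm_def]
  refine hbound.trans (le_of_eq ?_)
  rw [hG0, Prod.norm_def]
  have h1 : ‖F.I - (I₁ : ℚ_[p])‖ = ‖((I₁ - f₀.I : ℤ_[p]) : ℚ_[p])‖ := by
    rw [hFI, ← norm_neg, PadicInt.coe_sub]; congr 1; ring
  have h2 : ‖F.J - (J₁ : ℚ_[p])‖ = ‖((J₁ - f₀.J : ℤ_[p]) : ℚ_[p])‖ := by
    rw [hFJ, ← norm_neg, PadicInt.coe_sub]; congr 1; ring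
  change δ⁻¹ * max ‖F.I - (I₁ : ℚ_[p])‖ ‖F.J - (J₁ : ℚ_[p])‖ = _
  rw [h1, h2]
  rfl

/-- From a zero `(t, s)` of norm `≤ 1` of the `(a, c)`-family to an integral form with the prescribed
invariants. [folklore] -/
theorem exists_form_ac (f₀ : BinaryQuartic ℤ_[p]) (I₁ J₁ : ℤ_[p]) {t s : ℚ_[p]} (ht : ‖t‖ ≤ 1) (hs : ‖s‖ ≤ 1)
    (hI : (⟨(f₀.a : ℚ_[p]) + t, f₀.b, (f₀.c : ℚ_[p]) + s, f₀.d, f₀.e⟩ : BinaryQuartic ℚ_[p]).I = I₁)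
    (hJ : (⟨(f₀.a : ℚ_[p]) + t, f₀.b, (f₀.c : ℚ_[p]) + s, f₀.d, f₀.e⟩ : BinaryQuartic ℚ_[p]).J = J₁) :
    ∃ g : BinaryQuartic ℤ_[p], g.I = I₁ ∧ g.J = J₁ ∧ g.b = f₀.b ∧ g.d = f₀.d ∧ g.e = f₀.e ∧
      ((g.a - f₀.a : ℤ_[p]) : ℚ_[p]) = t ∧ ((g.c - f₀.c : ℤ_[p]) : ℚ_[p]) = s := by
  set g : BinaryQuartic ℤ_[p] := ⟨f₀.a + ⟨t, ht⟩, f₀.b, f₀.c + ⟨s, hs⟩, f₀.d, f₀.e⟩ with hg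
  have hmap : g.map PadicInt.Coe.ringHom =
      (⟨(f₀.a : ℚ_[p]) + t, f₀.b, (f₀.c : ℚ_[p]) + s, f₀.d, f₀.e⟩ : BinaryQuartic ℚ_[p]) := by
    ext <;> rfl
  refine ⟨g, ?_, ?_, rfl, rfl, rfl, ?_, ?_⟩
  · apply Subtype.coe_injective
    have := congrArg BinaryQuartic.I hmap
    rw [I_map] at this
    exact this.trans hI
  · apply Subtype.coe_injective
    have := congrArg BinaryQuartic.J hmap
    rw [J_map] at this
    exact this.trans hJ
  · change (((f₀.a + ⟨t, ht⟩ - f₀.a : ℤ_[p]) : ℚ_[p])) = t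
    rw [PadicInt.coe_sub, PadicInt.coe_add]; change (f₀.a : ℚ_[p]) + t - f₀.a = t; ring
  · change (((f₀.c + ⟨s, hs⟩ - f₀.c : ℤ_[p]) : ℚ_[p])) = s
    rw [PadicInt.coe_sub, PadicInt.coe_add]; change (f₀.c : ℚ_[p]) + s - f₀.c = s; ring

/-- **The local section in the coordinates `(a, b)`.** If the minor
`m = m_{ac} = (12e)(−6c² + 9bd + 72ae) − (2c)(−27d² + 72ce)` of the integral form `f₀` is nonzero (in `ℚ_p`)
and `max(|I₁ − I(f₀)|, |J₁ − J(f₀)|) ≤ |m|²/p`, there is an integral `g` with `(I, J)(g) = (I₁, J₁)`,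
`the other three coordinates of `g` equal to those of `f₀`` and `|a(g) − a(f₀)|, |c(g) − c(f₀)| ≤ |m|⁻¹ max(|I₁ − I(f₀)|, |J₁ − J(f₀)|)`.
[cite: BhargavaShankarAnnals2015, Prop. 5.12 (local structure of (I,J) over ℤ_p; arXiv:1006.1002v2 numbering)] -/
theorem exists_invariants_eq_near_of_minor_ac (f₀ : BinaryQuartic ℤ_[p]) (I₁ J₁ : ℤ_[p])
    (hm : (12 * (f₀.e : ℚ_[p])) * (-6 * (f₀.c : ℚ_[p]) ^ 2 + 9 * (f₀.b : ℚ_[p]) * f₀.d + 72 * (f₀.a : ℚ_[p]) * f₀.e)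
      - (2 * (f₀.c : ℚ_[p])) * (-27 * (f₀.d : ℚ_[p]) ^ 2 + 72 * (f₀.c : ℚ_[p]) * f₀.e) ≠ 0)
    (hsmall : max ‖((I₁ - f₀.I : ℤ_[p]) : ℚ_[p])‖ ‖((J₁ - f₀.J : ℤ_[p]) : ℚ_[p])‖ ≤
      ‖(12 * (f₀.e : ℚ_[p])) * (-6 * (f₀.c : ℚ_[p]) ^ 2 + 9 * (f₀.b : ℚ_[p]) * f₀.d + 72 * (f₀.a : ℚ_[p]) * f₀.e)
        - (2 * (f₀.c : ℚ_[p])) * (-27 * (f₀.d : ℚ_[p]) ^ 2 + 72 * (f₀.c : ℚ_[p]) * f₀.e)‖ *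
      (‖(12 * (f₀.e : ℚ_[p])) * (-6 * (f₀.c : ℚ_[p]) ^ 2 + 9 * (f₀.b : ℚ_[p]) * f₀.d + 72 * (f₀.a : ℚ_[p]) * f₀.e)
        - (2 * (f₀.c : ℚ_[p])) * (-27 * (f₀.d : ℚ_[p]) ^ 2 + 72 * (f₀.c : ℚ_[p]) * f₀.e)‖ / p)) :
    ∃ g : BinaryQuartic ℤ_[p], g.I = I₁ ∧ g.J = J₁ ∧ g.b = f₀.b ∧ g.d = f₀.d ∧ g.e = f₀.e ∧
      max ‖((g.a - f₀.a : ℤ_[p]) : ℚ_[p])‖ ‖((g.c - f₀.c : ℤ_[p]) : ℚ_[p])‖ ≤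
        ‖(12 * (f₀.e : ℚ_[p])) * (-6 * (f₀.c : ℚ_[p]) ^ 2 + 9 * (f₀.b : ℚ_[p]) * f₀.d + 72 * (f₀.a : ℚ_[p]) * f₀.e)
          - (2 * (f₀.c : ℚ_[p])) * (-27 * (f₀.d : ℚ_[p]) ^ 2 + 72 * (f₀.c : ℚ_[p]) * f₀.e)‖⁻¹ *
        max ‖((I₁ - f₀.I : ℤ_[p]) : ℚ_[p])‖ ‖((J₁ - f₀.J : ℤ_[p]) : ℚ_[p])‖ := by
  set F : BinaryQuartic ℚ_[p] := f₀.map PadicInt.Coe.ringHom with hF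
  have hFa : F.a = f₀.a := rfl
  have hFb : F.b = f₀.b := rfl
  have hFc : F.c = f₀.c := rfl
  have hFd : F.d = f₀.d := rfl
  have hFe : F.e = f₀.e := rfl
  have hFI : F.I = (f₀.I : ℚ_[p]) := I_map _ _
  have hFJ : F.J = (f₀.J : ℚ_[p]) := J_map _ _
  -- the data of the chord method
  set l₁₁ : ℚ_[p] := 12 * F.e
  set l₁₂ : ℚ_[p] := 2 * F.c
  set l₂₁ : ℚ_[p] := -27 * F.d ^ 2 + 72 * F.c * F.e
  set l₂₂ : ℚ_[p] := -6 * F.c ^ 2 + 9 * F.b * F.d + 72 * F.a * F.e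
  have ha1 := norm_coe_le_one f₀.a; have hb1 := norm_coe_le_one f₀.b; have hc1 := norm_coe_le_one f₀.c
  have hd1 := norm_coe_le_one f₀.d; have he1 := norm_coe_le_one f₀.e
  have h₁₁ : ‖l₁₁‖ ≤ 1 := norm_le_one_of_mul (norm_natCast_le_one' 12) he1
  have h₁₂ : ‖l₁₂‖ ≤ 1 := norm_le_one_of_mul (norm_natCast_le_one' 2) hc1
  have hd2 : ‖(F.d : ℚ_[p]) ^ 2‖ ≤ 1 := by rw [norm_pow]; exact pow_le_one₀ (norm_nonneg _) hd1
  have h27d2 : ‖-27 * (F.d : ℚ_[p]) ^ 2‖ ≤ 1 := by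
    rw [neg_mul, norm_neg]; exact norm_le_one_of_mul (norm_natCast_le_one' 27) hd2
  have h₂₁ : ‖l₂₁‖ ≤ 1 :=
    (norm_le_one_of_add_sub h27d2 (norm_le_one_of_mul (norm_le_one_of_mul (norm_natCast_le_one' 72) hc1) he1)).1
  have hc2 : ‖(F.c : ℚ_[p]) ^ 2‖ ≤ 1 := by rw [norm_pow]; exact pow_le_one₀ (norm_nonneg _) hc1
  have h6c2 : ‖-6 * (F.c : ℚ_[p]) ^ 2‖ ≤ 1 := by
    rw [neg_mul, norm_neg]; exact norm_le_one_of_mul (norm_natCast_le_one' 6) hc2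
  have h₂₂ : ‖l₂₂‖ ≤ 1 :=
    (norm_le_one_of_add_sub (norm_le_one_of_add_sub h6c2
        (norm_le_one_of_mul (norm_le_one_of_mul (norm_natCast_le_one' 9) hb1) hd1)).1
      (norm_le_one_of_mul (norm_le_one_of_mul (norm_natCast_le_one' 72) ha1) he1)).1
  have hdet : l₁₁ * l₂₂ - l₁₂ * l₂₁ ≠ 0 := hm
  set δ : ℝ := ‖l₁₁ * l₂₂ - l₁₂ * l₂₁‖ with hδ
  have hδ1 : δ ≤ 1 := norm_det_le_one h₁₁ h₁₂ h₂₁ h₂₂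
  have hp1 : (1 : ℝ) < p := by exact_mod_cast (Fact.out : p.Prime).one_lt
  have hr1 : δ / p ≤ 1 := (div_le_self (norm_nonneg _) hp1.le).trans hδ1
  -- the map and its remainder
  let fam : ℚ_[p] × ℚ_[p] → BinaryQuartic ℚ_[p] := fun h ↦ ⟨F.a + h.1, F.b, F.c + h.2, F.d, F.e⟩
  let G : ℚ_[p] × ℚ_[p] → ℚ_[p] × ℚ_[p] := fun h ↦ ((fam h).I - (I₁ : ℚ_[p]), (fam h).J - (J₁ : ℚ_[p]))
  let Q : ℚ_[p] × ℚ_[p] → ℚ_[p] × ℚ_[p] := fun h ↦ (h.2 ^ 2, 72 * F.e * (h.1 * h.2) - 6 * F.c * h.2 ^ 2 - 2 * h.2 ^ 3)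
  have hG0 : G 0 = (F.I - (I₁ : ℚ_[p]), F.J - (J₁ : ℚ_[p])) := by
    have h := I_J_family_ac F 0 0
    ext
    · change (fam 0).I - (I₁ : ℚ_[p]) = F.I - I₁
      rw [show fam 0 = ⟨F.a + 0, F.b, F.c + 0, F.d, F.e⟩ from rfl, h.1]; ring
    · change (fam 0).J - (J₁ : ℚ_[p]) = F.J - J₁
      rw [show fam 0 = ⟨F.a + 0, F.b, F.c + 0, F.d, F.e⟩ from rfl, h.2]; ring
  have hG : ∀ h, G h = G 0 + (l₁₁ * h.1 + l₁₂ * h.2, l₂₁ * h.1 + l₂₂ * h.2) + Q h := fun h ↦ by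
    have hh := I_J_family_ac F h.1 h.2
    rw [hG0]
    ext
    · change (fam h).I - (I₁ : ℚ_[p]) = (F.I - I₁) + (l₁₁ * h.1 + l₁₂ * h.2) + h.2 ^ 2
      rw [show fam h = ⟨F.a + h.1, F.b, F.c + h.2, F.d, F.e⟩ from rfl, hh.1]; ring
    · change (fam h).J - (J₁ : ℚ_[p]) = (F.J - J₁) + (l₂₁ * h.1 + l₂₂ * h.2) + (72 * F.e * (h.1 * h.2) - 6 * F.c * h.2 ^ 2 - 2 * h.2 ^ 3)
      rw [show fam h = ⟨F.a + h.1, F.b, F.c + h.2, F.d, F.e⟩ from rfl, hh.2]; ring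
  have hQ0 : Q 0 = 0 := by
    ext
    · change (0 : ℚ_[p]) ^ 2 = 0; ring
    · change 72 * F.e * ((0 : ℚ_[p]) * 0) - 6 * F.c * (0 : ℚ_[p]) ^ 2 - 2 * (0 : ℚ_[p]) ^ 3 = 0; ring
  have hQ : ∀ h ∈ closedBall (0 : ℚ_[p] × ℚ_[p]) (δ / p), ∀ h' ∈ closedBall (0 : ℚ_[p] × ℚ_[p]) (δ / p),
      ‖Q h - Q h'‖ ≤ δ / p * ‖h - h'‖ := fun h hh h' hh' ↦ by
    obtain ⟨hM, hM2, hdiff⟩ := ball_aux hr1 hh hh'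
    have hpos : 0 ≤ δ / p := by positivity
    rw [Prod.norm_def]
    refine max_le ?_ ?_
    · change ‖h.2 ^ 2 - h'.2 ^ 2‖ ≤ δ / p * ‖h - h'‖
      refine (norm_sq_sub_sq_le _ _).trans ?_
      rw [← hdiff]
      exact mul_le_mul ((le_max_right _ _).trans hM) (le_max_right _ _) (norm_nonneg _) hpos
    change ‖(72 * F.e * (h.1 * h.2) - 6 * F.c * h.2 ^ 2 - 2 * h.2 ^ 3)
        - (72 * F.e * (h'.1 * h'.2) - 6 * F.c * h'.2 ^ 2 - 2 * h'.2 ^ 3)‖ ≤ δ / p * ‖h - h'‖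
    have hc72 : ‖72 * F.e‖ ≤ 1 := norm_le_one_of_mul (norm_natCast_le_one' 72) he1
    have hc6 : ‖6 * F.c‖ ≤ 1 := norm_le_one_of_mul (norm_natCast_le_one' 6) hc1
    have hc2 : ‖(2 : ℚ_[p])‖ ≤ 1 := norm_natCast_le_one' 2
    have e1 : ‖72 * F.e * (h.1 * h.2) - 72 * F.e * (h'.1 * h'.2)‖ ≤ δ / p * ‖h - h'‖ := by
      refine (norm_coef_mul_sub_le hc72 _ _).trans ((norm_mul_sub_mul_le _ _ _ _).trans ?_)
      rw [hdiff]; exact mul_le_mul_of_nonneg_right hM (norm_nonneg _)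
    have e2 : ‖6 * F.c * h.2 ^ 2 - 6 * F.c * h'.2 ^ 2‖ ≤ δ / p * ‖h - h'‖ := by
      refine (norm_coef_mul_sub_le hc6 _ _).trans ((norm_sq_sub_sq_le _ _).trans ?_)
      rw [← hdiff]
      exact mul_le_mul ((le_max_right _ _).trans hM) (le_max_right _ _) (norm_nonneg _) hpos
    have e3 : ‖2 * h.2 ^ 3 - 2 * h'.2 ^ 3‖ ≤ δ / p * ‖h - h'‖ := by
      refine (norm_coef_mul_sub_le hc2 _ _).trans ((norm_cube_sub_cube_le _ _).trans ?_)
      rw [← hdiff]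
      refine mul_le_mul ?_ (le_max_right _ _) (norm_nonneg _) hpos
      exact (pow_le_pow_left₀ (by positivity) (le_max_right _ _) 2).trans hM2
    have hsplit : (72 * F.e * (h.1 * h.2) - 6 * F.c * h.2 ^ 2 - 2 * h.2 ^ 3)
        - (72 * F.e * (h'.1 * h'.2) - 6 * F.c * h'.2 ^ 2 - 2 * h'.2 ^ 3)
        = (72 * F.e * (h.1 * h.2) - 72 * F.e * (h'.1 * h'.2))
          + (-(6 * F.c * h.2 ^ 2 - 6 * F.c * h'.2 ^ 2) + -(2 * h.2 ^ 3 - 2 * h'.2 ^ 3)) := by ring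
    rw [hsplit]
    refine (Padic.nonarchimedean _ _).trans (max_le e1 ((Padic.nonarchimedean _ _).trans (max_le ?_ ?_)))
    · rw [norm_neg]; exact e2
    · rw [norm_neg]; exact e3
  have hsmall' : ‖G 0‖ ≤ δ * (δ / p) := by
    rw [hG0, Prod.norm_def]
    have h1 : ‖F.I - (I₁ : ℚ_[p])‖ = ‖((I₁ - f₀.I : ℤ_[p]) : ℚ_[p])‖ := by
      rw [hFI, ← norm_neg, PadicInt.coe_sub]; congr 1; ring
    have h2 : ‖F.J - (J₁ : ℚ_[p])‖ = ‖((J₁ - f₀.J : ℤ_[p]) : ℚ_[p])‖ := by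
      rw [hFJ, ← norm_neg, PadicInt.coe_sub]; congr 1; ring
    change max ‖F.I - (I₁ : ℚ_[p])‖ ‖F.J - (J₁ : ℚ_[p])‖ ≤ _
    rw [h1, h2]; exact hsmall
  obtain ⟨h, hGh, hbound, hball⟩ := exists_zero_of_chord h₁₁ h₁₂ h₂₁ h₂₂ hdet G Q hG hQ0 hQ hsmall'
  -- the zero gives the form
  have hh1 : ‖h.1‖ ≤ 1 := (norm_fst_le h).trans (hball.trans hr1)
  have hh2 : ‖h.2‖ ≤ 1 := (norm_snd_le h).trans (hball.trans hr1)
  have hI : (fam h).I = I₁ := sub_eq_zero.mp (congrArg Prod.fst hGh)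
  have hJ : (fam h).J = J₁ := sub_eq_zero.mp (congrArg Prod.snd hGh)
  obtain ⟨g, hgI, hgJ, hg1, hg2, hg3, hga, hgb⟩ := exists_form_ac f₀ I₁ J₁ hh1 hh2 hI hJ
  refine ⟨g, hgI, hgJ, hg1, hg2, hg3, ?_⟩
  rw [hga, hgb, ← Prod.norm_def]
  refine hbound.trans (le_of_eq ?_)
  rw [hG0, Prod.norm_def]
  have h1 : ‖F.I - (I₁ : ℚ_[p])‖ = ‖((I₁ - f₀.I : ℤ_[p]) : ℚ_[p])‖ := by
    rw [hFI, ← norm_neg, PadicInt.coe_sub]; congr 1; ring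
  have h2 : ‖F.J - (J₁ : ℚ_[p])‖ = ‖((J₁ - f₀.J : ℤ_[p]) : ℚ_[p])‖ := by
    rw [hFJ, ← norm_neg, PadicInt.coe_sub]; congr 1; ring
  change δ⁻¹ * max ‖F.I - (I₁ : ℚ_[p])‖ ‖F.J - (J₁ : ℚ_[p])‖ = _
  rw [h1, h2]
  rfl

/-- From a zero `(t, s)` of norm `≤ 1` of the `(a, d)`-family to an integral form with the prescribed
invariants. [folklore] -/
theorem exists_form_ad (f₀ : BinaryQuartic ℤ_[p]) (I₁ J₁ : ℤ_[p]) {t s : ℚ_[p]} (ht : ‖t‖ ≤ 1) (hs : ‖s‖ ≤ 1)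
    (hI : (⟨(f₀.a : ℚ_[p]) + t, f₀.b, f₀.c, (f₀.d : ℚ_[p]) + s, f₀.e⟩ : BinaryQuartic ℚ_[p]).I = I₁)
    (hJ : (⟨(f₀.a : ℚ_[p]) + t, f₀.b, f₀.c, (f₀.d : ℚ_[p]) + s, f₀.e⟩ : BinaryQuartic ℚ_[p]).J = J₁) :
    ∃ g : BinaryQuartic ℤ_[p], g.I = I₁ ∧ g.J = J₁ ∧ g.b = f₀.b ∧ g.c = f₀.c ∧ g.e = f₀.e ∧
      ((g.a - f₀.a : ℤ_[p]) : ℚ_[p]) = t ∧ ((g.d - f₀.d : ℤ_[p]) : ℚ_[p]) = s := by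
  set g : BinaryQuartic ℤ_[p] := ⟨f₀.a + ⟨t, ht⟩, f₀.b, f₀.c, f₀.d + ⟨s, hs⟩, f₀.e⟩ with hg
  have hmap : g.map PadicInt.Coe.ringHom =
      (⟨(f₀.a : ℚ_[p]) + t, f₀.b, f₀.c, (f₀.d : ℚ_[p]) + s, f₀.e⟩ : BinaryQuartic ℚ_[p]) := by
    ext <;> rfl
  refine ⟨g, ?_, ?_, rfl, rfl, rfl, ?_, ?_⟩
  · apply Subtype.coe_injective
    have := congrArg BinaryQuartic.I hmap
    rw [I_map] at this
    exact this.trans hI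
  · apply Subtype.coe_injective
    have := congrArg BinaryQuartic.J hmap
    rw [J_map] at this
    exact this.trans hJ
  · change (((f₀.a + ⟨t, ht⟩ - f₀.a : ℤ_[p]) : ℚ_[p])) = t
    rw [PadicInt.coe_sub, PadicInt.coe_add]; change (f₀.a : ℚ_[p]) + t - f₀.a = t; ring
  · change (((f₀.d + ⟨s, hs⟩ - f₀.d : ℤ_[p]) : ℚ_[p])) = s
    rw [PadicInt.coe_sub, PadicInt.coe_add]; change (f₀.d : ℚ_[p]) + s - f₀.d = s; ring

/-- **The local section in the coordinates `(a, b)`.** If the minor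
`m = m_{ad} = (12e)(9bc − 54ad) − (−3b)(−27d² + 72ce)` of the integral form `f₀` is nonzero (in `ℚ_p`)
and `max(|I₁ − I(f₀)|, |J₁ − J(f₀)|) ≤ |m|²/p`, there is an integral `g` with `(I, J)(g) = (I₁, J₁)`,
`the other three coordinates of `g` equal to those of `f₀`` and `|a(g) − a(f₀)|, |d(g) − d(f₀)| ≤ |m|⁻¹ max(|I₁ − I(f₀)|, |J₁ − J(f₀)|)`.
[cite: BhargavaShankarAnnals2015, Prop. 5.12 (local structure of (I,J) over ℤ_p; arXiv:1006.1002v2 numbering)] -/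
theorem exists_invariants_eq_near_of_minor_ad (f₀ : BinaryQuartic ℤ_[p]) (I₁ J₁ : ℤ_[p])
    (hm : (12 * (f₀.e : ℚ_[p])) * (9 * (f₀.b : ℚ_[p]) * f₀.c - 54 * (f₀.a : ℚ_[p]) * f₀.d)
      - (-3 * (f₀.b : ℚ_[p])) * (-27 * (f₀.d : ℚ_[p]) ^ 2 + 72 * (f₀.c : ℚ_[p]) * f₀.e) ≠ 0)
    (hsmall : max ‖((I₁ - f₀.I : ℤ_[p]) : ℚ_[p])‖ ‖((J₁ - f₀.J : ℤ_[p]) : ℚ_[p])‖ ≤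
      ‖(12 * (f₀.e : ℚ_[p])) * (9 * (f₀.b : ℚ_[p]) * f₀.c - 54 * (f₀.a : ℚ_[p]) * f₀.d)
        - (-3 * (f₀.b : ℚ_[p])) * (-27 * (f₀.d : ℚ_[p]) ^ 2 + 72 * (f₀.c : ℚ_[p]) * f₀.e)‖ *
      (‖(12 * (f₀.e : ℚ_[p])) * (9 * (f₀.b : ℚ_[p]) * f₀.c - 54 * (f₀.a : ℚ_[p]) * f₀.d)
        - (-3 * (f₀.b : ℚ_[p])) * (-27 * (f₀.d : ℚ_[p]) ^ 2 + 72 * (f₀.c : ℚ_[p]) * f₀.e)‖ / p)) :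
    ∃ g : BinaryQuartic ℤ_[p], g.I = I₁ ∧ g.J = J₁ ∧ g.b = f₀.b ∧ g.c = f₀.c ∧ g.e = f₀.e ∧
      max ‖((g.a - f₀.a : ℤ_[p]) : ℚ_[p])‖ ‖((g.d - f₀.d : ℤ_[p]) : ℚ_[p])‖ ≤
        ‖(12 * (f₀.e : ℚ_[p])) * (9 * (f₀.b : ℚ_[p]) * f₀.c - 54 * (f₀.a : ℚ_[p]) * f₀.d)
          - (-3 * (f₀.b : ℚ_[p])) * (-27 * (f₀.d : ℚ_[p]) ^ 2 + 72 * (f₀.c : ℚ_[p]) * f₀.e)‖⁻¹ *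
        max ‖((I₁ - f₀.I : ℤ_[p]) : ℚ_[p])‖ ‖((J₁ - f₀.J : ℤ_[p]) : ℚ_[p])‖ := by
  set F : BinaryQuartic ℚ_[p] := f₀.map PadicInt.Coe.ringHom with hF
  have hFa : F.a = f₀.a := rfl
  have hFb : F.b = f₀.b := rfl
  have hFc : F.c = f₀.c := rfl
  have hFd : F.d = f₀.d := rfl
  have hFe : F.e = f₀.e := rfl
  have hFI : F.I = (f₀.I : ℚ_[p]) := I_map _ _
  have hFJ : F.J = (f₀.J : ℚ_[p]) := J_map _ _
  -- the data of the chord method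
  set l₁₁ : ℚ_[p] := 12 * F.e
  set l₁₂ : ℚ_[p] := -3 * F.b
  set l₂₁ : ℚ_[p] := -27 * F.d ^ 2 + 72 * F.c * F.e
  set l₂₂ : ℚ_[p] := 9 * F.b * F.c - 54 * F.a * F.d
  have ha1 := norm_coe_le_one f₀.a; have hb1 := norm_coe_le_one f₀.b; have hc1 := norm_coe_le_one f₀.c
  have hd1 := norm_coe_le_one f₀.d; have he1 := norm_coe_le_one f₀.e
  have h₁₁ : ‖l₁₁‖ ≤ 1 := norm_le_one_of_mul (norm_natCast_le_one' 12) he1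
  have h₁₂ : ‖l₁₂‖ ≤ 1 := by
    change ‖-3 * (f₀.b : ℚ_[p])‖ ≤ 1
    rw [neg_mul, norm_neg]; exact norm_le_one_of_mul (norm_natCast_le_one' 3) hb1
  have hd2 : ‖(F.d : ℚ_[p]) ^ 2‖ ≤ 1 := by rw [norm_pow]; exact pow_le_one₀ (norm_nonneg _) hd1
  have h27d2 : ‖-27 * (F.d : ℚ_[p]) ^ 2‖ ≤ 1 := by
    rw [neg_mul, norm_neg]; exact norm_le_one_of_mul (norm_natCast_le_one' 27) hd2
  have h₂₁ : ‖l₂₁‖ ≤ 1 :=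
    (norm_le_one_of_add_sub h27d2 (norm_le_one_of_mul (norm_le_one_of_mul (norm_natCast_le_one' 72) hc1) he1)).1
  have h₂₂ : ‖l₂₂‖ ≤ 1 :=
    (norm_le_one_of_add_sub (norm_le_one_of_mul (norm_le_one_of_mul (norm_natCast_le_one' 9) hb1) hc1)
      (norm_le_one_of_mul (norm_le_one_of_mul (norm_natCast_le_one' 54) ha1) hd1)).2
  have hdet : l₁₁ * l₂₂ - l₁₂ * l₂₁ ≠ 0 := hm
  set δ : ℝ := ‖l₁₁ * l₂₂ - l₁₂ * l₂₁‖ with hδ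
  have hδ1 : δ ≤ 1 := norm_det_le_one h₁₁ h₁₂ h₂₁ h₂₂
  have hp1 : (1 : ℝ) < p := by exact_mod_cast (Fact.out : p.Prime).one_lt
  have hr1 : δ / p ≤ 1 := (div_le_self (norm_nonneg _) hp1.le).trans hδ1
  -- the map and its remainder
  let fam : ℚ_[p] × ℚ_[p] → BinaryQuartic ℚ_[p] := fun h ↦ ⟨F.a + h.1, F.b, F.c, F.d + h.2, F.e⟩
  let G : ℚ_[p] × ℚ_[p] → ℚ_[p] × ℚ_[p] := fun h ↦ ((fam h).I - (I₁ : ℚ_[p]), (fam h).J - (J₁ : ℚ_[p]))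
  let Q : ℚ_[p] × ℚ_[p] → ℚ_[p] × ℚ_[p] := fun h ↦ (0, -54 * F.d * (h.1 * h.2) - 27 * F.a * h.2 ^ 2 - 27 * (h.1 * h.2 ^ 2))
  have hG0 : G 0 = (F.I - (I₁ : ℚ_[p]), F.J - (J₁ : ℚ_[p])) := by
    have h := I_J_family_ad F 0 0
    ext
    · change (fam 0).I - (I₁ : ℚ_[p]) = F.I - I₁
      rw [show fam 0 = ⟨F.a + 0, F.b, F.c, F.d + 0, F.e⟩ from rfl, h.1]; ring
    · change (fam 0).J - (J₁ : ℚ_[p]) = F.J - J₁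
      rw [show fam 0 = ⟨F.a + 0, F.b, F.c, F.d + 0, F.e⟩ from rfl, h.2]; ring
  have hG : ∀ h, G h = G 0 + (l₁₁ * h.1 + l₁₂ * h.2, l₂₁ * h.1 + l₂₂ * h.2) + Q h := fun h ↦ by
    have hh := I_J_family_ad F h.1 h.2
    rw [hG0]
    ext
    · change (fam h).I - (I₁ : ℚ_[p]) = (F.I - I₁) + (l₁₁ * h.1 + l₁₂ * h.2) + 0
      rw [show fam h = ⟨F.a + h.1, F.b, F.c, F.d + h.2, F.e⟩ from rfl, hh.1]; ring
    · change (fam h).J - (J₁ : ℚ_[p]) = (F.J - J₁) + (l₂₁ * h.1 + l₂₂ * h.2) + (-54 * F.d * (h.1 * h.2) - 27 * F.a * h.2 ^ 2 - 27 * (h.1 * h.2 ^ 2))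
      rw [show fam h = ⟨F.a + h.1, F.b, F.c, F.d + h.2, F.e⟩ from rfl, hh.2]; ring
  have hQ0 : Q 0 = 0 := by
    ext
    · rfl
    · change -54 * F.d * ((0 : ℚ_[p]) * 0) - 27 * F.a * (0 : ℚ_[p]) ^ 2 - 27 * ((0 : ℚ_[p]) * (0 : ℚ_[p]) ^ 2) = 0; ring
  have hQ : ∀ h ∈ closedBall (0 : ℚ_[p] × ℚ_[p]) (δ / p), ∀ h' ∈ closedBall (0 : ℚ_[p] × ℚ_[p]) (δ / p),
      ‖Q h - Q h'‖ ≤ δ / p * ‖h - h'‖ := fun h hh h' hh' ↦ by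
    obtain ⟨hM, hM2, hdiff⟩ := ball_aux hr1 hh hh'
    have hpos : 0 ≤ δ / p := by positivity
    rw [Prod.norm_def]
    refine max_le ?_ ?_
    · change ‖(0 : ℚ_[p]) - 0‖ ≤ δ / p * ‖h - h'‖
      rw [sub_zero, norm_zero]; positivity
    change ‖(-54 * F.d * (h.1 * h.2) - 27 * F.a * h.2 ^ 2 - 27 * (h.1 * h.2 ^ 2))
        - (-54 * F.d * (h'.1 * h'.2) - 27 * F.a * h'.2 ^ 2 - 27 * (h'.1 * h'.2 ^ 2))‖ ≤ δ / p * ‖h - h'‖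
    have hc54 : ‖-54 * F.d‖ ≤ 1 := by
      rw [neg_mul, norm_neg]; exact norm_le_one_of_mul (norm_natCast_le_one' 54) hd1
    have hc27a : ‖27 * F.a‖ ≤ 1 := norm_le_one_of_mul (norm_natCast_le_one' 27) ha1
    have hc27 : ‖(27 : ℚ_[p])‖ ≤ 1 := norm_natCast_le_one' 27
    have e1 : ‖-54 * F.d * (h.1 * h.2) - -54 * F.d * (h'.1 * h'.2)‖ ≤ δ / p * ‖h - h'‖ := by
      refine (norm_coef_mul_sub_le hc54 _ _).trans ((norm_mul_sub_mul_le _ _ _ _).trans ?_)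
      rw [hdiff]; exact mul_le_mul_of_nonneg_right hM (norm_nonneg _)
    have e2 : ‖27 * F.a * h.2 ^ 2 - 27 * F.a * h'.2 ^ 2‖ ≤ δ / p * ‖h - h'‖ := by
      refine (norm_coef_mul_sub_le hc27a _ _).trans ((norm_sq_sub_sq_le _ _).trans ?_)
      rw [← hdiff]
      exact mul_le_mul ((le_max_right _ _).trans hM) (le_max_right _ _) (norm_nonneg _) hpos
    have e3 : ‖27 * (h.1 * h.2 ^ 2) - 27 * (h'.1 * h'.2 ^ 2)‖ ≤ δ / p * ‖h - h'‖ := by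
      refine (norm_coef_mul_sub_le hc27 _ _).trans ((norm_mul_sq_sub_le _ _ _ _).trans ?_)
      rw [hdiff]; exact mul_le_mul_of_nonneg_right hM2 (norm_nonneg _)
    have hsplit : (-54 * F.d * (h.1 * h.2) - 27 * F.a * h.2 ^ 2 - 27 * (h.1 * h.2 ^ 2))
        - (-54 * F.d * (h'.1 * h'.2) - 27 * F.a * h'.2 ^ 2 - 27 * (h'.1 * h'.2 ^ 2))
        = (-54 * F.d * (h.1 * h.2) - -54 * F.d * (h'.1 * h'.2))
          + (-(27 * F.a * h.2 ^ 2 - 27 * F.a * h'.2 ^ 2) + -(27 * (h.1 * h.2 ^ 2) - 27 * (h'.1 * h'.2 ^ 2))) := by ring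
    rw [hsplit]
    refine (Padic.nonarchimedean _ _).trans (max_le e1 ((Padic.nonarchimedean _ _).trans (max_le ?_ ?_)))
    · rw [norm_neg]; exact e2
    · rw [norm_neg]; exact e3
  have hsmall' : ‖G 0‖ ≤ δ * (δ / p) := by
    rw [hG0, Prod.norm_def]
    have h1 : ‖F.I - (I₁ : ℚ_[p])‖ = ‖((I₁ - f₀.I : ℤ_[p]) : ℚ_[p])‖ := by
      rw [hFI, ← norm_neg, PadicInt.coe_sub]; congr 1; ring
    have h2 : ‖F.J - (J₁ : ℚ_[p])‖ = ‖((J₁ - f₀.J : ℤ_[p]) : ℚ_[p])‖ := by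
      rw [hFJ, ← norm_neg, PadicInt.coe_sub]; congr 1; ring
    change max ‖F.I - (I₁ : ℚ_[p])‖ ‖F.J - (J₁ : ℚ_[p])‖ ≤ _
    rw [h1, h2]; exact hsmall
  obtain ⟨h, hGh, hbound, hball⟩ := exists_zero_of_chord h₁₁ h₁₂ h₂₁ h₂₂ hdet G Q hG hQ0 hQ hsmall'
  -- the zero gives the form
  have hh1 : ‖h.1‖ ≤ 1 := (norm_fst_le h).trans (hball.trans hr1)
  have hh2 : ‖h.2‖ ≤ 1 := (norm_snd_le h).trans (hball.trans hr1)
  have hI : (fam h).I = I₁ := sub_eq_zero.mp (congrArg Prod.fst hGh)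
  have hJ : (fam h).J = J₁ := sub_eq_zero.mp (congrArg Prod.snd hGh)
  obtain ⟨g, hgI, hgJ, hg1, hg2, hg3, hga, hgb⟩ := exists_form_ad f₀ I₁ J₁ hh1 hh2 hI hJ
  refine ⟨g, hgI, hgJ, hg1, hg2, hg3, ?_⟩
  rw [hga, hgb, ← Prod.norm_def]
  refine hbound.trans (le_of_eq ?_)
  rw [hG0, Prod.norm_def]
  have h1 : ‖F.I - (I₁ : ℚ_[p])‖ = ‖((I₁ - f₀.I : ℤ_[p]) : ℚ_[p])‖ := by
    rw [hFI, ← norm_neg, PadicInt.coe_sub]; congr 1; ring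
  have h2 : ‖F.J - (J₁ : ℚ_[p])‖ = ‖((J₁ - f₀.J : ℤ_[p]) : ℚ_[p])‖ := by
    rw [hFJ, ← norm_neg, PadicInt.coe_sub]; congr 1; ring
  change δ⁻¹ * max ‖F.I - (I₁ : ℚ_[p])‖ ‖F.J - (J₁ : ℚ_[p])‖ = _
  rw [h1, h2]
  rfl

/-! ## Assembly: local sections with controlled loss of precision -/

omit [Fact p.Prime] in
/-- A property of the five coefficient pairs of two forms, coordinate by coordinate. [folklore] -/
theorem forall_coeffs_iff₂ {R : Type*} [CommRing R] (P : R → R → Prop) (g f : BinaryQuartic R) :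
    (∀ i, P (g.coeffs i) (f.coeffs i)) ↔ P g.a f.a ∧ P g.b f.b ∧ P g.c f.c ∧ P g.d f.d ∧ P g.e f.e := by
  constructor
  · intro h; exact ⟨h 0, h 1, h 2, h 3, h 4⟩
  · rintro ⟨ha, hb, hc, hd, he⟩ i
    fin_cases i <;> assumption

/-- Divisibility by `pᵏ` from a norm bound on the image in `ℚ_p`. [folklore] -/
theorem pow_dvd_of_norm_coe_le {x : ℤ_[p]} {k : ℕ} (h : ‖(x : ℚ_[p])‖ ≤ (p : ℝ) ^ (-(k : ℤ))) :
    (p : ℤ_[p]) ^ k ∣ x := by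
  rw [PadicInt.padic_norm_e_of_padicInt] at h
  exact Ideal.mem_span_singleton.mp ((PadicInt.norm_le_pow_iff_mem_span_pow _ k).mp h)

/-- A norm bound from divisibility by `pⁿ`. [folklore] -/
theorem norm_coe_le_of_pow_dvd {x : ℤ_[p]} {n : ℕ} (h : (p : ℤ_[p]) ^ n ∣ x) :
    ‖(x : ℚ_[p])‖ ≤ (p : ℝ) ^ (-(n : ℤ)) := by
  rw [PadicInt.padic_norm_e_of_padicInt]
  exact (PadicInt.norm_le_pow_iff_mem_span_pow _ n).mpr (Ideal.mem_span_singleton.mpr h)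

omit [Fact p.Prime] in
/-- The arithmetic of the exponents: with `t = 1/p`, `tᴺ < δ` and `c = 2N + 1`,
`t^{k+c} ≤ δ²t` and `δ⁻¹ t^{k+c} ≤ tᵏ`. [folklore] -/
theorem exponent_aux [Fact p.Prime] {δ : ℝ} {N k : ℕ} (hδ : (p : ℝ) ^ (-(N : ℤ)) < δ) :
    (p : ℝ) ^ (-((k + (2 * N + 1) : ℕ) : ℤ)) ≤ δ * (δ / p) ∧
      δ⁻¹ * (p : ℝ) ^ (-((k + (2 * N + 1) : ℕ) : ℤ)) ≤ (p : ℝ) ^ (-(k : ℤ)) := by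
  have hp1 : (1 : ℝ) < p := by exact_mod_cast (Fact.out : p.Prime).one_lt
  have hppos : (0 : ℝ) < p := by linarith
  set t : ℝ := (p : ℝ)⁻¹ with ht
  have ht0 : 0 < t := inv_pos.mpr hppos
  have ht1 : t ≤ 1 := inv_le_one_of_one_le₀ hp1.le
  have hzpow : ∀ n : ℕ, (p : ℝ) ^ (-(n : ℤ)) = t ^ n := fun n ↦ by
    rw [zpow_neg, zpow_natCast, ht, inv_pow]
  rw [hzpow, hzpow]
  rw [hzpow] at hδ
  have hδpos : 0 < δ := lt_trans (pow_pos ht0 N) hδ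
  have htk : t ^ k ≤ 1 := pow_le_one₀ ht0.le ht1
  have htN1 : t ^ N ≤ 1 := pow_le_one₀ ht0.le ht1
  have hsplit : t ^ (k + (2 * N + 1)) = t ^ k * (t ^ N * t ^ N * t) := by ring
  constructor
  · rw [hsplit, show δ / (p : ℝ) = δ * t by rw [ht, div_eq_mul_inv]]
    calc t ^ k * (t ^ N * t ^ N * t) ≤ 1 * (δ * δ * t) := by
          refine mul_le_mul htk ?_ (by positivity) zero_le_one
          exact mul_le_mul_of_nonneg_right (mul_le_mul hδ.le hδ.le (by positivity) hδpos.le) ht0.le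
      _ = δ * (δ * t) := by ring
  · rw [hsplit]
    calc δ⁻¹ * (t ^ k * (t ^ N * t ^ N * t)) = t ^ k * ((t ^ N / δ) * t ^ N * t) := by
          field_simp
      _ ≤ t ^ k * (1 * 1 * 1) := by
          refine mul_le_mul_of_nonneg_left ?_ (by positivity)
          refine mul_le_mul (mul_le_mul ((div_le_one hδpos).mpr hδ.le) htN1 (by positivity) zero_le_one) ht1
            ht0.le (by positivity)
      _ = t ^ k := by ring

/-- **Local sections of the invariant map over `ℤ_p`.** For `f₀ ∈ V_{ℤ_p}` with `Δ(f₀) ≠ 0` there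
is `c` (namely `2N + 1` where `p⁻ᴺ` is below the norm of a nonzero Jacobian minor of `(I, J)` at
`f₀`) such that for every `k` and all `(I₁, J₁) ≡ (I(f₀), J(f₀)) (mod p^{k+c})` there is an
integral form `g ≡ f₀ (mod pᵏ)` (coefficientwise) with `I(g) = I₁` and `J(g) = J₁`.
[cite: BhargavaShankarAnnals2015, Prop. 5.12 (local structure of (I,J) over ℤ_p; arXiv:1006.1002v2 numbering)] -/
theorem exists_invariants_eq_near (f₀ : BinaryQuartic ℤ_[p]) (hΔ : f₀.disc ≠ 0) :
    ∃ c : ℕ, ∀ (k : ℕ) (I₁ J₁ : ℤ_[p]),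
      (p : ℤ_[p]) ^ (k + c) ∣ I₁ - f₀.I → (p : ℤ_[p]) ^ (k + c) ∣ J₁ - f₀.J →
      ∃ g : BinaryQuartic ℤ_[p], g.I = I₁ ∧ g.J = J₁ ∧ ∀ i, (p : ℤ_[p]) ^ k ∣ g.coeffs i - f₀.coeffs i := by
  have h2 : (2 : ℚ_[p]) ≠ 0 := by norm_num
  have h3 : (3 : ℚ_[p]) ≠ 0 := by norm_num
  have hΔF : (f₀.map PadicInt.Coe.ringHom).disc ≠ 0 := by
    rw [disc_map]; exact fun h ↦ hΔ (PadicInt.coe_eq_zero.mp h)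
  have hmin := jacobianMinor_ne_zero_of_disc_ne_zero h2 h3 hΔF
  change (12 * (f₀.e : ℚ_[p])) * (9 * (f₀.c : ℚ_[p]) * f₀.d - 54 * (f₀.b : ℚ_[p]) * f₀.e)
      - (-3 * (f₀.d : ℚ_[p])) * (-27 * (f₀.d : ℚ_[p]) ^ 2 + 72 * (f₀.c : ℚ_[p]) * f₀.e) ≠ 0 ∨
    (12 * (f₀.e : ℚ_[p])) * (-6 * (f₀.c : ℚ_[p]) ^ 2 + 9 * (f₀.b : ℚ_[p]) * f₀.d + 72 * (f₀.a : ℚ_[p]) * f₀.e)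
      - (2 * (f₀.c : ℚ_[p])) * (-27 * (f₀.d : ℚ_[p]) ^ 2 + 72 * (f₀.c : ℚ_[p]) * f₀.e) ≠ 0 ∨
    (12 * (f₀.e : ℚ_[p])) * (9 * (f₀.b : ℚ_[p]) * f₀.c - 54 * (f₀.a : ℚ_[p]) * f₀.d)
      - (-3 * (f₀.b : ℚ_[p])) * (-27 * (f₀.d : ℚ_[p]) ^ 2 + 72 * (f₀.c : ℚ_[p]) * f₀.e) ≠ 0 at hmin
  -- a common packaging of the three cases
  have key : ∀ (m : ℚ_[p]), m ≠ 0 →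
      (∀ I₁ J₁ : ℤ_[p], max ‖((I₁ - f₀.I : ℤ_[p]) : ℚ_[p])‖ ‖((J₁ - f₀.J : ℤ_[p]) : ℚ_[p])‖ ≤ ‖m‖ * (‖m‖ / p) →
        ∃ g : BinaryQuartic ℤ_[p], g.I = I₁ ∧ g.J = J₁ ∧
          (‖((g.a - f₀.a : ℤ_[p]) : ℚ_[p])‖ ≤ ‖m‖⁻¹ * max ‖((I₁ - f₀.I : ℤ_[p]) : ℚ_[p])‖ ‖((J₁ - f₀.J : ℤ_[p]) : ℚ_[p])‖ ∧
           ‖((g.b - f₀.b : ℤ_[p]) : ℚ_[p])‖ ≤ ‖m‖⁻¹ * max ‖((I₁ - f₀.I : ℤ_[p]) : ℚ_[p])‖ ‖((J₁ - f₀.J : ℤ_[p]) : ℚ_[p])‖ ∧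
           ‖((g.c - f₀.c : ℤ_[p]) : ℚ_[p])‖ ≤ ‖m‖⁻¹ * max ‖((I₁ - f₀.I : ℤ_[p]) : ℚ_[p])‖ ‖((J₁ - f₀.J : ℤ_[p]) : ℚ_[p])‖ ∧
           ‖((g.d - f₀.d : ℤ_[p]) : ℚ_[p])‖ ≤ ‖m‖⁻¹ * max ‖((I₁ - f₀.I : ℤ_[p]) : ℚ_[p])‖ ‖((J₁ - f₀.J : ℤ_[p]) : ℚ_[p])‖ ∧
           ‖((g.e - f₀.e : ℤ_[p]) : ℚ_[p])‖ ≤ ‖m‖⁻¹ * max ‖((I₁ - f₀.I : ℤ_[p]) : ℚ_[p])‖ ‖((J₁ - f₀.J : ℤ_[p]) : ℚ_[p])‖)) →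
      ∃ c : ℕ, ∀ (k : ℕ) (I₁ J₁ : ℤ_[p]),
        (p : ℤ_[p]) ^ (k + c) ∣ I₁ - f₀.I → (p : ℤ_[p]) ^ (k + c) ∣ J₁ - f₀.J →
        ∃ g : BinaryQuartic ℤ_[p], g.I = I₁ ∧ g.J = J₁ ∧ ∀ i, (p : ℤ_[p]) ^ k ∣ g.coeffs i - f₀.coeffs i := by
    intro m hm hcase
    obtain ⟨N, hN⟩ := PadicInt.exists_pow_neg_lt p (norm_pos_iff.mpr hm)
    refine ⟨2 * N + 1, fun k I₁ J₁ hI hJ ↦ ?_⟩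
    obtain ⟨hA, hB⟩ := exponent_aux (k := k) hN
    have hmax : max ‖((I₁ - f₀.I : ℤ_[p]) : ℚ_[p])‖ ‖((J₁ - f₀.J : ℤ_[p]) : ℚ_[p])‖ ≤
        (p : ℝ) ^ (-((k + (2 * N + 1) : ℕ) : ℤ)) :=
      max_le (norm_coe_le_of_pow_dvd hI) (norm_coe_le_of_pow_dvd hJ)
    obtain ⟨g, hgI, hgJ, hg⟩ := hcase I₁ J₁ (hmax.trans hA)
    set B : ℝ := ‖m‖⁻¹ * max ‖((I₁ - f₀.I : ℤ_[p]) : ℚ_[p])‖ ‖((J₁ - f₀.J : ℤ_[p]) : ℚ_[p])‖ with hBdef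
    have hall : ∀ i, ‖((g.coeffs i - f₀.coeffs i : ℤ_[p]) : ℚ_[p])‖ ≤ B :=
      (forall_coeffs_iff₂ (fun x y ↦ ‖((x - y : ℤ_[p]) : ℚ_[p])‖ ≤ B) g f₀).mpr hg
    refine ⟨g, hgI, hgJ, fun i ↦ pow_dvd_of_norm_coe_le ((hall i).trans ?_)⟩
    exact (mul_le_mul_of_nonneg_left hmax (inv_nonneg.mpr (norm_nonneg _))).trans hB
  rcases hmin with hm | hm | hm
  · refine key _ hm fun I₁ J₁ hsm ↦ ?_
    obtain ⟨g, hgI, hgJ, hgc, hgd, hge, hgn⟩ := exists_invariants_eq_near_of_minor_ab f₀ I₁ J₁ hm hsm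
    refine ⟨g, hgI, hgJ, (le_max_left _ _).trans hgn, (le_max_right _ _).trans hgn, ?_, ?_, ?_⟩
    · rw [hgc, sub_self, PadicInt.coe_zero, norm_zero]; positivity
    · rw [hgd, sub_self, PadicInt.coe_zero, norm_zero]; positivity
    · rw [hge, sub_self, PadicInt.coe_zero, norm_zero]; positivity
  · refine key _ hm fun I₁ J₁ hsm ↦ ?_
    obtain ⟨g, hgI, hgJ, hgb, hgd, hge, hgn⟩ := exists_invariants_eq_near_of_minor_ac f₀ I₁ J₁ hm hsm
    refine ⟨g, hgI, hgJ, (le_max_left _ _).trans hgn, ?_, (le_max_right _ _).trans hgn, ?_, ?_⟩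
    · rw [hgb, sub_self, PadicInt.coe_zero, norm_zero]; positivity
    · rw [hgd, sub_self, PadicInt.coe_zero, norm_zero]; positivity
    · rw [hge, sub_self, PadicInt.coe_zero, norm_zero]; positivity
  · refine key _ hm fun I₁ J₁ hsm ↦ ?_
    obtain ⟨g, hgI, hgJ, hgb, hgc, hge, hgn⟩ := exists_invariants_eq_near_of_minor_ad f₀ I₁ J₁ hm hsm
    refine ⟨g, hgI, hgJ, (le_max_left _ _).trans hgn, ?_, ?_, (le_max_right _ _).trans hgn, ?_⟩
    · rw [hgb, sub_self, PadicInt.coe_zero, norm_zero]; positivity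
    · rw [hgc, sub_self, PadicInt.coe_zero, norm_zero]; positivity
    · rw [hge, sub_self, PadicInt.coe_zero, norm_zero]; positivity

/-- **Congruence form with the sets of the tree**: the image of the residue class
`{g ≡ f₀ (mod pᵏ)}` under `(I, J)` contains the residue class of `(I(f₀), J(f₀))` modulo `p^{k+c}`.
[cite: BhargavaShankarAnnals2015, Prop. 5.12 (arXiv:1006.1002v2 numbering)] -/
theorem invariants_image_congr_class_superset (f₀ : BinaryQuartic ℤ_[p]) (hΔ : f₀.disc ≠ 0) :
    ∃ c : ℕ, ∀ k : ℕ,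
      {IJ : ℤ_[p] × ℤ_[p] | (p : ℤ_[p]) ^ (k + c) ∣ IJ.1 - f₀.I ∧ (p : ℤ_[p]) ^ (k + c) ∣ IJ.2 - f₀.J} ⊆
        (fun g : BinaryQuartic ℤ_[p] ↦ (g.I, g.J)) ''
          {g : BinaryQuartic ℤ_[p] | ∀ i, (p : ℤ_[p]) ^ k ∣ g.coeffs i - f₀.coeffs i} := by
  obtain ⟨c, hc⟩ := exists_invariants_eq_near f₀ hΔ
  refine ⟨c, fun k IJ hIJ ↦ ?_⟩
  obtain ⟨g, hgI, hgJ, hg⟩ := hc k IJ.1 IJ.2 hIJ.1 hIJ.2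
  exact ⟨g, hg, Prod.ext hgI hgJ⟩

end BinaryQuartic

end Literature.NumberTheory.EllipticCurves

end
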